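import Mathlib
import Literature.AlgebraicGeometry.Resolution.WeightedResolutionDatum
import Literature.AlgebraicGeometry.Resolution.CobordantBlowupGlobal
import Literature.AlgebraicGeometry.Resolution.Principalization
import HarnessLib

/-!
# Terminating weighted-centre data — the door crux of route `WeightedInvariant` re-typed to what its
deciding theorem consumes

Route `ResolutionOfSingularities/WeightedInvariant` (route-ResolutionOfSingularities-WeightedInvariant),
repair planner `res-wc-repair-plan-1` (cell res-hironaka, brief: director-resolution 2026-08-26,
`Cruxes/WeightedConstruction/STRATEGY-CENSUS.md` §6, tri-2 `REFUTE-L1.md`).  DEFINITIONS ONLY, import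
cycle-free (this module does NOT import the route file, so the route file can import it): two posited
interfaces and their conversion, plus the induction engines.  Nothing is asserted about Hironaka's
problem; `Nonempty (… p)` for all primes `p` is a CANDIDATE crux, never a fact.

CENSUS behind the re-typing (what `closes (hC : WeightedConstruction) (hE : DatumToEmbedded)
(hD : DescentPerfectToAll)` consumes of `Literature.AlgebraicGeometry.Resolution.WeightedResolutionDatum p`;
the datum enters only through `hE`'s hypothesis, i.e. through the landed consumer
`Theorems/WeightedInvariantDatumToEmbedded*.lean`, 44 files): `centre`; `isRegularWeightedCentre_centre`
(iii-a); `isBot_inv_iff` (ii) only as a detector of the regular locus; `support_centre` (iii-b) only as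
"a point of the centre has non-minimal `inv`" (generic point of `X` off the centre); `centre_comap` (i)
only for the action / projection maps of a graded affine chart, i.e. only as HOMOGENEITY of the centre on
`ℤʲ`-graded charts; and `wellFoundedLT` + `isClosed_superlevel` + `inv_comap` (one open immersion) +
`inv_cobordantPlus_lt` (iv) only to feed the induction hypothesis at the CANONICAL SUCCESSOR pair
`(B₊ → Y → Spec k, σˢ(X)|_{B₊})`.  `inv_baseChange`, `centre_baseChange` are unused.

* `TerminatingCentreDatum p` — the relaxed interface on ALL pairs (closed subschemes of smooth `Y`).
* `HypersurfaceTerminatingCentreDatum p` — the same with every axiom restricted to HYPERSURFACE pairs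
  (`X` locally principal with integral subscheme), the weakest door the landed reductions support
  (`Theorems/WeightedInvariantWeightedThesisHypersurfacesIff.lean`: every integral variety is birational to
  a hypersurface in a smooth ambient; `…HypersurfacePreserved.lean`: the successor of a hypersurface pair
  is a hypersurface pair).
* `HypersurfaceTerminatingCentreDatum.ofTerminating`, the engines `rank_induction`.
* (sibling module `WeightedInvariantTerminatingCentreDatumRank.lean`, split off for the 400-line lint)
  `CentreRankDatum p` — the `inv`-free normal form of `TerminatingCentreDatum p` and the two conversions
  (the rating `inv` carries no content beyond the singular locus of `X`).

The consumers (datum ⇒ resolution over perfect fields, modulo Bergh–Rydh) and `ofDatum :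
WeightedResolutionDatum p → TerminatingCentreDatum p` live in the companion module
`WeightedInvariantTerminatingCentreDatumConsumer.lean` (which imports the route file).
-/

noncomputable section

open CategoryTheory AlgebraicGeometry TopologicalSpace
open Literature.AlgebraicGeometry.Resolution

set_option linter.dupNamespace false -- mandated namespace of this single-conjunct summit

namespace Summit.ResolutionOfSingularities.ResolutionOfSingularities.Theorems

/-! ## The relaxed interface on all pairs -/

/-- **Terminating weighted-centre datum in characteristic `p`** — the interface
`Literature.AlgebraicGeometry.Resolution.WeightedResolutionDatum p` of route `WeightedInvariant` cut down
to what the route's deciding theorem consumes.  Data: a linearly ordered value type `Γ` and a total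
rating `inv f X : Y → Γ` (consumed ONLY through `(ii)`, i.e. as a detector of the regular locus — a
construction may take `Γ := Bool`, see `CentreRankDatum`); a total Rees algebra `centre f X` on `Y`; a
well-ordered type `Λ` and a total `rank f X : Λ` of PAIRS.  Axioms, for `k` perfect of characteristic
`p`, `f : Y → Spec k` smooth separated quasi-compact, and (except `(ii)`) under the guard "`inv` not
everywhere minimal" (= `X.subscheme` not regular): `(ii)` `inv` minimal at `y` iff `X` is regular over
`y`; `(iii-a)` the centre is a regular weighted centre; `(iii-b′)` its support lies in the non-minimal
locus of `inv` (no maximum locus, no exactness); `(hom)` on every affine chart `W` with a `ℤʲ`-grading of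
`Γ(Y, W)` (constants in degree `0`, `X(W)` homogeneous) every piece of the centre is homogeneous (torus
equivariance — replaces functoriality for smooth surjective morphisms); `(term)` the rank strictly drops
from `(Y, X)` to the canonical successor `(B₊, σˢ(X)|_{B₊})`, `B₊ → Y` the global cobordant blow-up of
any Rees filtration with the pieces of the centre (replaces: `Γ` well-founded, `(usc)`, functoriality of
`inv` for smooth morphisms and base change, and the chartwise drop `(iv)`).
CANDIDATE, not a claim: `∀ p prime, Nonempty (TerminatingCentreDatum p)` is the proposed re-typed door
crux `TerminatingCentreConstruction`. -/
structure TerminatingCentreDatum (p : ℕ) : Type 1 where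
  /-- the value set of the rating -/
  Γ : Type
  /-- `Γ` is linearly ordered (NOT assumed well-founded) -/
  [linearOrder : LinearOrder Γ]
  /-- the rating `inv_{(Y,X)} : |Y| → Γ` (total; consumed only through `(ii)`) -/
  inv : ∀ ⦃k : Type⦄ [Field k] ⦃Y : Scheme.{0}⦄, (Y ⟶ Spec (.of k)) → Y.IdealSheafData → Y → Γ
  /-- the weighted centre of `(Y, X)`, as a Rees algebra on `Y` (total) -/
  centre : ∀ ⦃k : Type⦄ [Field k] ⦃Y : Scheme.{0}⦄, (Y ⟶ Spec (.of k)) → Y.IdealSheafData →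
    ReesAlgebraData Y
  /-- the value set of the termination rank -/
  Λ : Type
  /-- `Λ` is linearly ordered … -/
  [linearOrderRank : LinearOrder Λ]
  /-- … and well-ordered -/
  [wellFoundedLTRank : WellFoundedLT Λ]
  /-- the termination rank of a PAIR `(f : Y → Spec k, X)` (total) -/
  rank : ∀ ⦃k : Type⦄ [Field k] ⦃Y : Scheme.{0}⦄, (Y ⟶ Spec (.of k)) → Y.IdealSheafData → Λ
  /-- `(ii)` `inv` is minimal at `y` iff `y ∉ X` or the local ring of `X` at `y` is regular -/
  isBot_inv_iff : ∀ ⦃k : Type⦄ [Field k] [CharP k p] [PerfectField k] ⦃Y : Scheme.{0}⦄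
    (f : Y ⟶ Spec (.of k)) [Smooth f] [IsSeparated f] [QuasiCompact f] (X : Y.IdealSheafData)
    (y : Y), IsBot (inv f X y) ↔
      ∀ x : X.subscheme, X.subschemeι x = y → IsRegularLocalRing (X.subscheme.presheaf.stalk x)
  /-- `(iii-a)` [guard: `inv` not everywhere minimal] the centre is a regular weighted centre -/
  isRegularWeightedCentre_centre : ∀ ⦃k : Type⦄ [Field k] [CharP k p] [PerfectField k]
    ⦃Y : Scheme.{0}⦄ (f : Y ⟶ Spec (.of k)) [Smooth f] [IsSeparated f] [QuasiCompact f]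
    (X : Y.IdealSheafData), (∃ y : Y, ¬ IsBot (inv f X y)) →
    (centre f X).IsRegularWeightedCentre
  /-- `(iii-b′)` [guard] the centre is supported inside the locus where `inv` is not minimal
  (i.e. inside the non-regular locus of `X`; NO relation to a maximum locus) -/
  support_centre_subset : ∀ ⦃k : Type⦄ [Field k] [CharP k p] [PerfectField k]
    ⦃Y : Scheme.{0}⦄ (f : Y ⟶ Spec (.of k)) [Smooth f] [IsSeparated f] [QuasiCompact f]
    (X : Y.IdealSheafData), (∃ y : Y, ¬ IsBot (inv f X y)) →
    (centre f X).support ⊆ {y : Y | ¬ IsBot (inv f X y)}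
  /-- `(hom)` [guard] on a `ℤʲ`-graded affine chart `W` (constants in degree `0`, `X(W)` homogeneous)
  every piece of the centre has homogeneous ideal of sections over `W` -/
  centre_isHomogeneous : ∀ ⦃k : Type⦄ [Field k] [CharP k p] [PerfectField k]
    ⦃Y : Scheme.{0}⦄ (f : Y ⟶ Spec (.of k)) [Smooth f] [IsSeparated f] [QuasiCompact f]
    (X : Y.IdealSheafData), (∃ y : Y, ¬ IsBot (inv f X y)) →
    ∀ (j : ℕ) (W : Y.affineOpens) (𝒜 : (Fin j → ℤ) → AddSubgroup Γ(Y, W)) [GradedRing 𝒜],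
      (∀ c : Γ(Spec (.of k), ⊤), f.appLE ⊤ W le_top c ∈ 𝒜 0) →
      (X.ideal W).IsHomogeneous 𝒜 →
      ∀ n : ℕ, (((centre f X).piece n).ideal W).IsHomogeneous 𝒜
  /-- `(term)` [guard] the rank drops from `(Y, X)` to the canonical successor pair
  `(B₊ → Y → Spec k, σˢ(X)|_{B₊})`, for any Rees filtration `R'` with the pieces of the centre -/
  rank_lt : ∀ ⦃k : Type⦄ [Field k] [CharP k p] [PerfectField k]
    ⦃Y : Scheme.{0}⦄ (f : Y ⟶ Spec (.of k)) [Smooth f] [IsSeparated f] [QuasiCompact f]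
    (X : Y.IdealSheafData), (∃ y : Y, ¬ IsBot (inv f X y)) →
    ∀ (R' : ReesFiltration Y), R'.ideal = (centre f X).piece →
      rank (R'.πPlus ≫ f) (R'.strictTransformPlus X) < rank f X

namespace TerminatingCentreDatum

variable {p : ℕ} (E : TerminatingCentreDatum p)

/-- The value set of the rating is linearly ordered (structure field as an instance). [folklore] -/
instance instLinearOrder : LinearOrder E.Γ := E.linearOrder

/-- The rank set is linearly ordered (structure field as an instance). [folklore] -/
instance instLinearOrderRank : LinearOrder E.Λ := E.linearOrderRank

/-- The rank set is well-ordered (structure field as an instance). [folklore] -/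
instance instWellFoundedLTRank : WellFoundedLT E.Λ := E.wellFoundedLTRank

/-- `(ii)` globally: `inv` of `(Y, X)` is everywhere minimal iff the closed subscheme `V(X)` is
regular. [folklore] -/
theorem forall_isBot_inv_iff {k : Type} [Field k] [CharP k p] [PerfectField k] {Y : Scheme.{0}}
    (f : Y ⟶ Spec (.of k)) [Smooth f] [IsSeparated f] [QuasiCompact f] (X : Y.IdealSheafData) :
    (∀ y : Y, IsBot (E.inv f X y)) ↔ Scheme.IsRegular X.subscheme := by
  constructor
  · intro h x
    exact (E.isBot_inv_iff f X (X.subschemeι x)).mp (h _) x rfl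
  · intro h y
    rw [E.isBot_inv_iff f X y]
    exact fun x _ => h x

/-- **Induction engine of the relaxed interface.** A property `Q` of pairs `(f : Y → Spec k, I)`
(`Y` smooth separated quasi-compact over the perfect field `k`) that holds in the resolved case
(`inv` everywhere minimal) and holds at an unresolved pair as soon as it holds at every pair of
strictly smaller rank, holds always (well-founded induction on `rank ∈ E.Λ`). [folklore] -/
theorem rank_induction {k : Type} [Field k] [CharP k p] [PerfectField k]
    (Q : ∀ (Y : Scheme.{0}), (Y ⟶ Spec (.of k)) → Y.IdealSheafData → Prop)
    (base : ∀ (Y : Scheme.{0}) (f : Y ⟶ Spec (.of k)) [Smooth f] [IsSeparated f] [QuasiCompact f]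
      (I : Y.IdealSheafData), (∀ y : Y, IsBot (E.inv f I y)) → Q Y f I)
    (step : ∀ (Y : Scheme.{0}) (f : Y ⟶ Spec (.of k)) [Smooth f] [IsSeparated f] [QuasiCompact f]
      (I : Y.IdealSheafData), (∃ y : Y, ¬ IsBot (E.inv f I y)) →
      (∀ (Y₁ : Scheme.{0}) (f₁ : Y₁ ⟶ Spec (.of k)) [Smooth f₁] [IsSeparated f₁] [QuasiCompact f₁]
        (I₁ : Y₁.IdealSheafData), E.rank f₁ I₁ < E.rank f I → Q Y₁ f₁ I₁) →
      Q Y f I)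
    (Y : Scheme.{0}) (f : Y ⟶ Spec (.of k)) [Smooth f] [IsSeparated f] [QuasiCompact f]
    (I : Y.IdealSheafData) : Q Y f I := by
  have key : ∀ (r : E.Λ) (Y : Scheme.{0}) (f : Y ⟶ Spec (.of k)) [Smooth f] [IsSeparated f]
      [QuasiCompact f] (I : Y.IdealSheafData), E.rank f I = r → Q Y f I := by
    intro r
    induction r using WellFoundedLT.induction with
    | ind r ih =>
      intro Y f _ _ _ I hr
      by_cases hbot : ∀ y : Y, IsBot (E.inv f I y)
      · exact base Y f I hbot
      · push Not at hbot
        refine step Y f I hbot ?_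
        intro Y₁ f₁ _ _ _ I₁ hlt
        exact ih (E.rank f₁ I₁) (hr ▸ hlt) Y₁ f₁ I₁ rfl
  exact key (E.rank f I) Y f I rfl

end TerminatingCentreDatum

/-! ## The relaxed interface on hypersurface pairs -/

/-- **Terminating weighted-centre datum on HYPERSURFACE pairs in characteristic `p`** — the same
interface as `TerminatingCentreDatum p` with every axiom restricted to pairs `(Y, X)` whose ideal `X`
is locally principal with integral closed subscheme `V(X)` (integral hypersurfaces of the smooth `Y`).
This is the weakest door the landed reductions of route `WeightedInvariant` support: every integral
variety over a perfect field is birational to such a hypersurface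
(`WeightedThesis.HypersurfacesIff.hasResolution_of_hypersurfaces`) and the canonical successor of a
hypersurface pair is a hypersurface pair (`WeightedThesis.HypersurfacePreserved`).
CANDIDATE, not a claim: `∀ p prime, Nonempty (HypersurfaceTerminatingCentreDatum p)` is the proposed
door crux `HypersurfaceCentreConstruction`. -/
structure HypersurfaceTerminatingCentreDatum (p : ℕ) : Type 1 where
  /-- the value set of the rating -/
  Γ : Type
  /-- `Γ` is linearly ordered (NOT assumed well-founded) -/
  [linearOrder : LinearOrder Γ]
  /-- the rating `inv_{(Y,X)} : |Y| → Γ` (total; consumed only through `(ii)`) -/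
  inv : ∀ ⦃k : Type⦄ [Field k] ⦃Y : Scheme.{0}⦄, (Y ⟶ Spec (.of k)) → Y.IdealSheafData → Y → Γ
  /-- the weighted centre of `(Y, X)`, as a Rees algebra on `Y` (total) -/
  centre : ∀ ⦃k : Type⦄ [Field k] ⦃Y : Scheme.{0}⦄, (Y ⟶ Spec (.of k)) → Y.IdealSheafData →
    ReesAlgebraData Y
  /-- the value set of the termination rank -/
  Λ : Type
  /-- `Λ` is linearly ordered … -/
  [linearOrderRank : LinearOrder Λ]
  /-- … and well-ordered -/
  [wellFoundedLTRank : WellFoundedLT Λ]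
  /-- the termination rank of a PAIR (total) -/
  rank : ∀ ⦃k : Type⦄ [Field k] ⦃Y : Scheme.{0}⦄, (Y ⟶ Spec (.of k)) → Y.IdealSheafData → Λ
  /-- `(ii)` on hypersurface pairs -/
  isBot_inv_iff : ∀ ⦃k : Type⦄ [Field k] [CharP k p] [PerfectField k] ⦃Y : Scheme.{0}⦄
    (f : Y ⟶ Spec (.of k)) [Smooth f] [IsSeparated f] [QuasiCompact f] (X : Y.IdealSheafData),
    IsLocallyPrincipal X → IsIntegral X.subscheme → ∀ (y : Y), IsBot (inv f X y) ↔
      ∀ x : X.subscheme, X.subschemeι x = y → IsRegularLocalRing (X.subscheme.presheaf.stalk x)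
  /-- `(iii-a)` on hypersurface pairs [guard] -/
  isRegularWeightedCentre_centre : ∀ ⦃k : Type⦄ [Field k] [CharP k p] [PerfectField k]
    ⦃Y : Scheme.{0}⦄ (f : Y ⟶ Spec (.of k)) [Smooth f] [IsSeparated f] [QuasiCompact f]
    (X : Y.IdealSheafData), IsLocallyPrincipal X → IsIntegral X.subscheme →
    (∃ y : Y, ¬ IsBot (inv f X y)) → (centre f X).IsRegularWeightedCentre
  /-- `(iii-b′)` on hypersurface pairs [guard] -/
  support_centre_subset : ∀ ⦃k : Type⦄ [Field k] [CharP k p] [PerfectField k]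
    ⦃Y : Scheme.{0}⦄ (f : Y ⟶ Spec (.of k)) [Smooth f] [IsSeparated f] [QuasiCompact f]
    (X : Y.IdealSheafData), IsLocallyPrincipal X → IsIntegral X.subscheme →
    (∃ y : Y, ¬ IsBot (inv f X y)) → (centre f X).support ⊆ {y : Y | ¬ IsBot (inv f X y)}
  /-- `(hom)` on hypersurface pairs [guard] -/
  centre_isHomogeneous : ∀ ⦃k : Type⦄ [Field k] [CharP k p] [PerfectField k]
    ⦃Y : Scheme.{0}⦄ (f : Y ⟶ Spec (.of k)) [Smooth f] [IsSeparated f] [QuasiCompact f]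
    (X : Y.IdealSheafData), IsLocallyPrincipal X → IsIntegral X.subscheme →
    (∃ y : Y, ¬ IsBot (inv f X y)) →
    ∀ (j : ℕ) (W : Y.affineOpens) (𝒜 : (Fin j → ℤ) → AddSubgroup Γ(Y, W)) [GradedRing 𝒜],
      (∀ c : Γ(Spec (.of k), ⊤), f.appLE ⊤ W le_top c ∈ 𝒜 0) →
      (X.ideal W).IsHomogeneous 𝒜 →
      ∀ n : ℕ, (((centre f X).piece n).ideal W).IsHomogeneous 𝒜
  /-- `(term)` on hypersurface pairs [guard] -/
  rank_lt : ∀ ⦃k : Type⦄ [Field k] [CharP k p] [PerfectField k]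
    ⦃Y : Scheme.{0}⦄ (f : Y ⟶ Spec (.of k)) [Smooth f] [IsSeparated f] [QuasiCompact f]
    (X : Y.IdealSheafData), IsLocallyPrincipal X → IsIntegral X.subscheme →
    (∃ y : Y, ¬ IsBot (inv f X y)) →
    ∀ (R' : ReesFiltration Y), R'.ideal = (centre f X).piece →
      rank (R'.πPlus ≫ f) (R'.strictTransformPlus X) < rank f X

namespace HypersurfaceTerminatingCentreDatum

variable {p : ℕ} (E : HypersurfaceTerminatingCentreDatum p)

/-- The value set of the rating is linearly ordered (structure field as an instance). [folklore] -/
instance instLinearOrder : LinearOrder E.Γ := E.linearOrder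

/-- The rank set is linearly ordered (structure field as an instance). [folklore] -/
instance instLinearOrderRank : LinearOrder E.Λ := E.linearOrderRank

/-- The rank set is well-ordered (structure field as an instance). [folklore] -/
instance instWellFoundedLTRank : WellFoundedLT E.Λ := E.wellFoundedLTRank

/-- **Every terminating centre datum is a hypersurface terminating centre datum** (forget the axioms
on non-hypersurface pairs): the hypersurface door is implied by the general door. [folklore] -/
def ofTerminating (E : TerminatingCentreDatum p) : HypersurfaceTerminatingCentreDatum p where
  Γ := E.Γ
  inv := E.inv
  centre := E.centre
  Λ := E.Λ
  rank := E.rank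
  isBot_inv_iff := fun _ _ _ _ _ f _ _ _ X _ _ y => E.isBot_inv_iff f X y
  isRegularWeightedCentre_centre := fun _ _ _ _ _ f _ _ _ X _ _ h =>
    E.isRegularWeightedCentre_centre f X h
  support_centre_subset := fun _ _ _ _ _ f _ _ _ X _ _ h => E.support_centre_subset f X h
  centre_isHomogeneous := fun _ _ _ _ _ f _ _ _ X _ _ h j W 𝒜 _ h0 hX n =>
    E.centre_isHomogeneous f X h j W 𝒜 h0 hX n
  rank_lt := fun _ _ _ _ _ f _ _ _ X _ _ h R' hR' => E.rank_lt f X h R' hR'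

/-- Hence `Nonempty` transfers from the general to the hypersurface interface. [folklore] -/
theorem nonempty_of_nonempty (h : Nonempty (TerminatingCentreDatum p)) :
    Nonempty (HypersurfaceTerminatingCentreDatum p) :=
  h.map ofTerminating

/-- `(ii)` globally on a hypersurface pair: `inv` is everywhere minimal iff `V(X)` is regular.
[folklore] -/
theorem forall_isBot_inv_iff {k : Type} [Field k] [CharP k p] [PerfectField k] {Y : Scheme.{0}}
    (f : Y ⟶ Spec (.of k)) [Smooth f] [IsSeparated f] [QuasiCompact f] (X : Y.IdealSheafData)
    (hX : IsLocallyPrincipal X) (hXi : IsIntegral X.subscheme) :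
    (∀ y : Y, IsBot (E.inv f X y)) ↔ Scheme.IsRegular X.subscheme := by
  constructor
  · intro h x
    exact (E.isBot_inv_iff f X hX hXi (X.subschemeι x)).mp (h _) x rfl
  · intro h y
    rw [E.isBot_inv_iff f X hX hXi y]
    exact fun x _ => h x

/-- **Induction engine on hypersurface pairs**: a property of hypersurface pairs that holds in the
resolved case and holds at an unresolved hypersurface pair as soon as it holds at every hypersurface
pair of strictly smaller rank, holds for every hypersurface pair. [folklore] -/
theorem rank_induction {k : Type} [Field k] [CharP k p] [PerfectField k]
    (Q : ∀ (Y : Scheme.{0}), (Y ⟶ Spec (.of k)) → Y.IdealSheafData → Prop)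
    (base : ∀ (Y : Scheme.{0}) (f : Y ⟶ Spec (.of k)) [Smooth f] [IsSeparated f] [QuasiCompact f]
      (I : Y.IdealSheafData), IsLocallyPrincipal I → IsIntegral I.subscheme →
      (∀ y : Y, IsBot (E.inv f I y)) → Q Y f I)
    (step : ∀ (Y : Scheme.{0}) (f : Y ⟶ Spec (.of k)) [Smooth f] [IsSeparated f] [QuasiCompact f]
      (I : Y.IdealSheafData), IsLocallyPrincipal I → IsIntegral I.subscheme →
      (∃ y : Y, ¬ IsBot (E.inv f I y)) →
      (∀ (Y₁ : Scheme.{0}) (f₁ : Y₁ ⟶ Spec (.of k)) [Smooth f₁] [IsSeparated f₁] [QuasiCompact f₁]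
        (I₁ : Y₁.IdealSheafData), IsLocallyPrincipal I₁ → IsIntegral I₁.subscheme →
        E.rank f₁ I₁ < E.rank f I → Q Y₁ f₁ I₁) →
      Q Y f I)
    (Y : Scheme.{0}) (f : Y ⟶ Spec (.of k)) [Smooth f] [IsSeparated f] [QuasiCompact f]
    (I : Y.IdealSheafData) (hI : IsLocallyPrincipal I) (hIi : IsIntegral I.subscheme) : Q Y f I := by
  have key : ∀ (r : E.Λ) (Y : Scheme.{0}) (f : Y ⟶ Spec (.of k)) [Smooth f] [IsSeparated f]
      [QuasiCompact f] (I : Y.IdealSheafData), IsLocallyPrincipal I → IsIntegral I.subscheme →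
      E.rank f I = r → Q Y f I := by
    intro r
    induction r using WellFoundedLT.induction with
    | ind r ih =>
      intro Y f _ _ _ I hI hIi hr
      by_cases hbot : ∀ y : Y, IsBot (E.inv f I y)
      · exact base Y f I hI hIi hbot
      · push Not at hbot
        refine step Y f I hI hIi hbot ?_
        intro Y₁ f₁ _ _ _ I₁ hI₁ hI₁i hlt
        exact ih (E.rank f₁ I₁) (hr ▸ hlt) Y₁ f₁ I₁ hI₁ hI₁i rfl
  exact key (E.rank f I) Y f I hI hIi rfl

end HypersurfaceTerminatingCentreDatum

end Summit.ResolutionOfSingularities.ResolutionOfSingularities.Theorems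

end
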